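import Mathlib
import Literature.NumberTheory.Transcendental.KZRayDilog
import Literature.NumberTheory.Transcendental.KZIdealTetrahedron
import Literature.NumberTheory.Transcendental.KZCalculusProofs
import Literature.NumberTheory.Transcendental.BlochWignerIdealTetrahedronVolume
import Literature.NumberTheory.Transcendental.SemialgebraicMapsProofs
import Literature.NumberTheory.Transcendental.KZSemialgebraicComplex

/-!
# `OffTetraSectorKernel`, line `flat-shadow`: the fan cell (stub `stub_fanCell`)

Stub `stub_fanCell` of the crux `OffTetraSectorKernel` (stmt-KontsevichZagierPeriods-10557, route
HyperbolicBloch): Kontsevich–Zagier's rule (2) for the FAN MAP of the base triangle. Notation: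
`z = a + ib` algebraic, `b > 0`, `N = |z|²`, `Q(s) = (1 − sa)² + (sb)²`,
`h(s, λ) = Q(s)(1 − λ) + N s(1 − s)`, `pw(w) = b(w₀ − w₀² − w₁²) + (N − a) w₁` (minus the power of
the point `w` with respect to the circle through `0, 1, z`); coordinates `v 0 = s`, `v 1 = λ`. The
fan map `Φ(s, λ) = (1 − λ) · 1 + λ · (s z) = (1 − λ + λ s a, λ s b)` (`IdealTetrahedronVolume.param`)
maps the open unit square `(0,1)²` injectively ONTO the open triangle `Δ(0, 1, z)` (tree facts
`image_param`, `injOn_param`), with derivative `jac z v` of determinant `λ b > 0`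
(`hasFDerivAt_param`, `det_jac`), and `pw(Φ(s, λ)) = b λ h(s, λ)` (`fanCell_pw_param`). Hence the
flat-shadow density pulls back to `b/(2 pw(Φ v)) · |det DΦ(v)| = b/(2 h(s, λ))`, the fan density:
`[(0,1)², b/(2h)] − [Δ, b/(2 pw)]` is ONE element of `KZ.changeOfVariablesRel`, and a representation
`[(0,1)², b/(2h)]` EXISTS (rational box; quotient integrand with real-algebraic coefficients and
denominator `2h > 0`; integrable by Mathlib's change-of-variables criterion
`MeasureTheory.integrableOn_image_iff_integrableOn_abs_det_fderiv_smul` read from the flat shadow,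
`Δ = Φ((0,1)²)`).

References: M. Kontsevich, D. Zagier, *Periods* (2001), §1.2 rule (2); J. Milnor, *Hyperbolic
geometry: the first 150 years* (1982), Appendix; J. Bochnak, M. Coste, M.-F. Roy, *Real Algebraic
Geometry* (1998), §2.2 (Prop. 2.2.6).
-/

noncomputable section

open Set MeasureTheory MvPolynomial
open Literature.NumberTheory.Transcendental Literature.ModelTheory.ExponentialFields
open Literature.NumberTheory.Transcendental.IdealTetrahedronVolume (param param_zero param_one sq01
  tri jac det_jac injOn_param image_param hasFDerivAt_param measurableSet_sq01 normSq_pos_of_im_pos)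

namespace Summit.KontsevichZagierPeriods.HyperbolicBloch.OffTetraSectorKernel

variable {z : ℂ}

/-! ## Algebra of the fan map -/

/-- **The power identity** `pw(Φ(s, λ)) = b · λ · h(s, λ)`: minus the power of the fan point
`Φ(s, λ) = (1 − λ + λ s a, λ s b)` with respect to the circle through `0, 1, z` factors through the
fan parameter `λ` and `h(s, λ) = Q(s)(1 − λ) + |z|² s(1 − s)`. [folklore] -/
theorem fanCell_pw_param (z : ℂ) (v : Fin 2 → ℝ) :
    z.im * (param z v 0 - param z v 0 ^ 2 - param z v 1 ^ 2) +
        (Complex.normSq z - z.re) * param z v 1 =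
      z.im * v 1 * (((1 - v 0 * z.re) ^ 2 + (v 0 * z.im) ^ 2) * (1 - v 1) +
        Complex.normSq z * v 0 * (1 - v 0)) := by
  simp only [param_zero, param_one, Complex.normSq_apply]
  ring

/-- `h(s, λ) = Q(s)(1 − λ) + |z|² s(1 − s) > 0` on the unit square (`Q > 0`, `|z|² > 0`).
[folklore] -/
theorem fanCell_h_pos (hz : 0 < z.im) {v : Fin 2 → ℝ} (hv : v ∈ sq01) :
    0 < ((1 - v 0 * z.re) ^ 2 + (v 0 * z.im) ^ 2) * (1 - v 1) +
      Complex.normSq z * v 0 * (1 - v 0) := by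
  obtain ⟨h0, h1, -, hl1⟩ := hv
  have hQ := KZ.rayDilog_den_pos hz.ne' z.re (v 0)
  have hA : 0 < ((1 - v 0 * z.re) ^ 2 + (v 0 * z.im) ^ 2) * (1 - v 1) :=
    mul_pos hQ (by linarith)
  have hB : 0 < Complex.normSq z * v 0 * (1 - v 0) :=
    mul_pos (mul_pos (normSq_pos_of_im_pos hz) h0) (by linarith)
  exact add_pos hA hB

/-- **The Jacobian identity of the fan move**: on the unit square,
`b/(2 h(s, λ)) = b/(2 pw(Φ(s, λ))) · |det DΦ(s, λ)|` (`det DΦ = λ b > 0`, `pw ∘ Φ = b λ h`).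
[cite: KontsevichZagier2001, §1.2 rule (2)] -/
theorem fanCell_jacobian (hz : 0 < z.im) {v : Fin 2 → ℝ} (hv : v ∈ sq01) :
    z.im / (2 * (((1 - v 0 * z.re) ^ 2 + (v 0 * z.im) ^ 2) * (1 - v 1) +
        Complex.normSq z * v 0 * (1 - v 0))) =
      z.im / (2 * (z.im * (param z v 0 - param z v 0 ^ 2 - param z v 1 ^ 2) +
        (Complex.normSq z - z.re) * param z v 1)) * |(jac z v).det| := by
  have hh := (fanCell_h_pos hz hv).ne'
  have hl : 0 < v 1 := hv.2.2.1
  have hl' := hl.ne'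
  have hb := hz.ne'
  rw [fanCell_pw_param, det_jac, abs_of_pos (mul_pos hl hz)]
  field_simp

/-! ## Semialgebraicity -/

/-- The open unit square `(0,1)²` is `ℚ`-semialgebraic (four rational linear inequalities).
[cite: BochnakCosteRoy1998, §2.2] -/
theorem fanCell_isSemialgebraic_sq01 : IsSemialgebraic ℚ sq01 := by
  have hU : IsSemialgebraic ℚ (univ : Set (Fin 2 → ℝ)) := isSemialgebraic_univ
  have s0 : IsSemialgebraicFunOn ℚ (univ : Set (Fin 2 → ℝ)) (fun w => w 0) :=
    (isSemialgebraicFunOn_aeval hU (X 0)).congr fun w _ => by simp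
  have s1 : IsSemialgebraicFunOn ℚ (univ : Set (Fin 2 → ℝ)) (fun w => w 1) :=
    (isSemialgebraicFunOn_aeval hU (X 1)).congr fun w _ => by simp
  have sone : IsSemialgebraicFunOn ℚ (univ : Set (Fin 2 → ℝ)) (fun _ => (1 : ℝ)) := by
    simpa using isSemialgebraicFunOn_natCast (k := ℚ) (R := ℝ) hU 1
  have szero : IsSemialgebraicFunOn ℚ (univ : Set (Fin 2 → ℝ)) (fun _ => (0 : ℝ)) := by
    simpa using isSemialgebraicFunOn_natCast (k := ℚ) (R := ℝ) hU 0
  show IsSemialgebraic ℚ {v : Fin 2 → ℝ | 0 < v 0 ∧ v 0 < 1 ∧ 0 < v 1 ∧ v 1 < 1}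
  exact (isSemialgebraic_setOf_lt_of_isSemialgebraicFunOn szero s0).inter
    ((isSemialgebraic_setOf_lt_of_isSemialgebraicFunOn s0 sone).inter
      ((isSemialgebraic_setOf_lt_of_isSemialgebraicFunOn szero s1).inter
        (isSemialgebraic_setOf_lt_of_isSemialgebraicFunOn s1 sone)))

/-- The fan map is a `ℚ`-semialgebraic map on every `ℚ`-semialgebraic set when `Re z`, `Im z` are
algebraic: its coordinates `1 − λ + λ s Re z`, `λ s Im z` are polynomials with real-algebraic
coefficients, and real-algebraic constants are `ℚ`-definable
(`isSemialgebraicFunOn_const_of_isAlgebraic`). [cite: KontsevichZagier2001, §1.1] -/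
theorem fanCell_isSemialgebraicMapOn (hre : IsAlgebraic ℚ z.re) (him : IsAlgebraic ℚ z.im)
    {σ : Set (Fin 2 → ℝ)} (hσ : IsSemialgebraic ℚ σ) : IsSemialgebraicMapOn ℚ σ (param z) := by
  have s0 : IsSemialgebraicFunOn ℚ σ (fun w => w 0) :=
    (isSemialgebraicFunOn_aeval hσ (X 0)).congr fun w _ => by simp
  have s1 : IsSemialgebraicFunOn ℚ σ (fun w => w 1) :=
    (isSemialgebraicFunOn_aeval hσ (X 1)).congr fun w _ => by simp
  have sone : IsSemialgebraicFunOn ℚ σ (fun _ => (1 : ℝ)) := by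
    simpa using isSemialgebraicFunOn_natCast (k := ℚ) (R := ℝ) hσ 1
  have sre : IsSemialgebraicFunOn ℚ σ (fun _ => z.re) :=
    isSemialgebraicFunOn_const_of_isAlgebraic hσ hre
  have sim : IsSemialgebraicFunOn ℚ σ (fun _ => z.im) :=
    isSemialgebraicFunOn_const_of_isAlgebraic hσ him
  refine IsSemialgebraicMapOn.of_forall hσ fun j => ?_
  fin_cases j
  · exact (IsSemialgebraicFunOn.add_holds (IsSemialgebraicFunOn.sub_holds sone s1)
      (IsSemialgebraicFunOn.mul_holds (IsSemialgebraicFunOn.mul_holds s1 s0) sre)).congr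
      fun w _ => by simp
  · exact (IsSemialgebraicFunOn.mul_holds (IsSemialgebraicFunOn.mul_holds s1 s0) sim).congr
      fun w _ => by simp

/-- The fan density `b/(2 h(s, λ))` is a `ℚ`-semialgebraic function on the unit square for algebraic
`Re z`, `Im z`: a quotient of polynomials with real-algebraic coefficients whose denominator `2h`
does not vanish on `(0,1)²` (`h > 0`). [cite: KontsevichZagier2001, §1.1] -/
theorem fanCell_isSemialgebraicFunOn (hre : IsAlgebraic ℚ z.re) (him : IsAlgebraic ℚ z.im)
    (hz : 0 < z.im) :
    IsSemialgebraicFunOn ℚ sq01 (fun v => z.im / (2 * (((1 - v 0 * z.re) ^ 2 + (v 0 * z.im) ^ 2) *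
      (1 - v 1) + Complex.normSq z * v 0 * (1 - v 0)))) := by
  have hσ : IsSemialgebraic ℚ sq01 := fanCell_isSemialgebraic_sq01
  have s0 : IsSemialgebraicFunOn ℚ sq01 (fun w => w 0) :=
    (isSemialgebraicFunOn_aeval hσ (X 0)).congr fun w _ => by simp
  have s1 : IsSemialgebraicFunOn ℚ sq01 (fun w => w 1) :=
    (isSemialgebraicFunOn_aeval hσ (X 1)).congr fun w _ => by simp
  have sone : IsSemialgebraicFunOn ℚ sq01 (fun _ => (1 : ℝ)) := by
    simpa using isSemialgebraicFunOn_natCast (k := ℚ) (R := ℝ) hσ 1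
  have stwo : IsSemialgebraicFunOn ℚ sq01 (fun _ => (2 : ℝ)) := by
    simpa using isSemialgebraicFunOn_natCast (k := ℚ) (R := ℝ) hσ 2
  have sre : IsSemialgebraicFunOn ℚ sq01 (fun _ => z.re) :=
    isSemialgebraicFunOn_const_of_isAlgebraic hσ hre
  have sim : IsSemialgebraicFunOn ℚ sq01 (fun _ => z.im) :=
    isSemialgebraicFunOn_const_of_isAlgebraic hσ him
  have sN : IsSemialgebraicFunOn ℚ sq01 (fun _ => Complex.normSq z) := by
    refine isSemialgebraicFunOn_const_of_isAlgebraic hσ ?_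
    rw [Complex.normSq_apply]
    exact (hre.mul hre).add (him.mul him)
  -- `Q(s) = (1 - s a)(1 - s a) + (s b)(s b)` and `2 h`
  have sQa := IsSemialgebraicFunOn.sub_holds sone (IsSemialgebraicFunOn.mul_holds s0 sre)
  have sQb := IsSemialgebraicFunOn.mul_holds s0 sim
  have sden : IsSemialgebraicFunOn ℚ sq01 (fun v => 2 * (((1 - v 0 * z.re) ^ 2 + (v 0 * z.im) ^ 2) *
      (1 - v 1) + Complex.normSq z * v 0 * (1 - v 0))) := by
    refine (IsSemialgebraicFunOn.mul_holds stwo (IsSemialgebraicFunOn.add_holds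
      (IsSemialgebraicFunOn.mul_holds
        (IsSemialgebraicFunOn.add_holds (IsSemialgebraicFunOn.mul_holds sQa sQa)
          (IsSemialgebraicFunOn.mul_holds sQb sQb))
        (IsSemialgebraicFunOn.sub_holds sone s1))
      (IsSemialgebraicFunOn.mul_holds (IsSemialgebraicFunOn.mul_holds sN s0)
        (IsSemialgebraicFunOn.sub_holds sone s0)))).congr fun v _ => ?_
    simp only [Pi.mul_apply, Pi.add_apply, Pi.sub_apply]
    ring
  exact IsSemialgebraicFunOn.div sim sden fun v hv => (mul_pos two_pos (fanCell_h_pos hz hv)).ne'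

/-! ## The stub -/

/-- **STUB `stub_fanCell`** (fan cell; Kontsevich–Zagier's rule (2) for the fan map
`Φ(s, λ) = (1 − λ + λ s Re z, λ s Im z)` of `(0,1)²` onto `Δ(0, 1, z)`). For algebraic `z` with
`Im z > 0` and every flat-shadow representation `s = [Δ(0,1,z), b/(2 pw)]`: a fan-cell
representation `f = [(0,1)², b/(2h)]`, `h(s, λ) = Q(s)(1 − λ) + |z|² s(1 − s)`, EXISTS (rational box;
quotient integrand with real-algebraic coefficients and denominator `2h > 0`; integrable by the
change-of-variables criterion since `Δ = Φ((0,1)²)` and the pulled-back density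
`|det DΦ| · b/(2 pw ∘ Φ)` IS `b/(2h)` on the square), and EVERY such `f` is KZ-equivalent to `s` by
the single move `[f] − [s] ∈ changeOfVariablesRel` (`Φ` semialgebraic, injective on the square,
derivative `jac` of determinant `λ b`, image `Δ`, `b/(2h) = b/(2 pw ∘ Φ) · |det DΦ|`).
[cite: KontsevichZagier2001, §1.2 rule (2)] -/
theorem stub_fanCell : ∀ z : ℂ, IsAlgebraic ℚ z → 0 < z.im → ∀ s : Literature.NumberTheory.Transcendental.KZ.IntegralRep 2, s.domain = {w | 0 < w 1 ∧ z.re * w 1 < z.im * w 0 ∧ z.im * (w 0 - 1) < (z.re - 1) * w 1} → Set.EqOn s.integrand (fun w => z.im / (2 * (z.im * (w 0 - w 0 ^ 2 - w 1 ^ 2) + (Complex.normSq z - z.re) * w 1))) s.domain → (∃ f : Literature.NumberTheory.Transcendental.KZ.IntegralRep 2, f.domain = {v | 0 < v 0 ∧ v 0 < 1 ∧ 0 < v 1 ∧ v 1 < 1} ∧ Set.EqOn f.integrand (fun v => z.im / (2 * (((1 - v 0 * z.re) ^ 2 + (v 0 * z.im) ^ 2) * (1 - v 1) + Complex.normSq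 z * v 0 * (1 - v 0)))) f.domain) ∧ (∀ f : Literature.NumberTheory.Transcendental.KZ.IntegralRep 2, f.domain = {v | 0 < v 0 ∧ v 0 < 1 ∧ 0 < v 1 ∧ v 1 < 1} → Set.EqOn f.integrand (fun v => z.im / (2 * (((1 - v 0 * z.re) ^ 2 + (v 0 * z.im) ^ 2) * (1 - v 1) + Complex.normSq z * v 0 * (1 - v 0)))) f.domain → Literature.NumberTheory.Transcendental.KZ.Equivalent s f) := by
  intro z hz him s hs hsi
  obtain ⟨hre, him'⟩ := isAlgebraic_re_im hz
  -- the flat shadow is the image of the square under the fan map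
  have hs' : s.domain = tri z := hs
  have hdom : s.domain = param z '' sq01 := by rw [hs', image_param him]
  -- the pulled-back density is the fan density
  have hpull : ∀ v ∈ sq01, |(jac z v).det| • s.integrand (param z v) =
      z.im / (2 * (((1 - v 0 * z.re) ^ 2 + (v 0 * z.im) ^ 2) * (1 - v 1) +
        Complex.normSq z * v 0 * (1 - v 0))) := by
    intro v hv
    have hpv : param z v ∈ s.domain := by
      rw [hdom]
      exact mem_image_of_mem _ hv
    rw [hsi hpv, smul_eq_mul, mul_comm]
    exact (fanCell_jacobian him hv).symm
  -- EXISTENCE of `[(0,1)², b/(2h)]`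
  have hT : IsSemialgebraic ℚ sq01 := fanCell_isSemialgebraic_sq01
  have hF := fanCell_isSemialgebraicFunOn hre him' him
  have hI : IntegrableOn (fun v : Fin 2 → ℝ => z.im / (2 * (((1 - v 0 * z.re) ^ 2 + (v 0 * z.im) ^ 2) *
      (1 - v 1) + Complex.normSq z * v 0 * (1 - v 0)))) sq01 := by
    have h1 : IntegrableOn s.integrand (param z '' sq01) := by
      rw [← hdom]
      exact s.integrableOn
    have h2 := (integrableOn_image_iff_integrableOn_abs_det_fderiv_smul volume measurableSet_sq01
      (fun v _ => (hasFDerivAt_param z v).hasFDerivWithinAt) (injOn_param him) s.integrand).1 h1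
    exact h2.congr_fun (fun v hv => hpull v hv) measurableSet_sq01
  refine ⟨⟨⟨sq01, _, hT, hF, hI⟩, rfl, fun _ _ => rfl⟩, ?_⟩
  -- EVERY `[(0,1)², b/(2h)]` is one change-of-variables move away from `s`
  intro f hf hfi
  have hf' : f.domain = sq01 := hf
  have hmove : KZ.Equivalent f s := by
    refine KZ.changeOfVariablesRel_subset_relations
      ⟨2, f, s, param z, jac z, fanCell_isSemialgebraicMapOn hre him' f.isSemialgebraic_domain,
        fun v _ => (hasFDerivAt_param z v).hasFDerivWithinAt, ?_, ?_, fun v hv => ?_, rfl⟩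
    · rw [hf']
      exact injOn_param him
    · rw [hf']
      exact hdom
    · have hv' : v ∈ sq01 := by
        rw [← hf']
        exact hv
      have hpv : param z v ∈ s.domain := by
        rw [hdom]
        exact mem_image_of_mem _ hv'
      rw [hfi hv, hsi hpv]
      exact fanCell_jacobian him hv'
  exact hmove.symm

end Summit.KontsevichZagierPeriods.HyperbolicBloch.OffTetraSectorKernel

end
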